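import Summits.AtomisticToContinuum.BoseEinsteinCondensation.Theorems.BECCellInformationOneBodyEntropyBoundInsertionIntegrable
import Summits.AtomisticToContinuum.BoseEinsteinCondensation.Theorems.BECCellInformationOneBodyEntropyBoundDenseCellLEB

/-!
# Crux `OneBodyEntropyBound` (stmt-AtomisticToContinuum-13440), line `registered`: stub `stub_insertionAssembly`,
# part 1 — slices along the bath and the pointwise calculus of the dressed product

Support file (`--supports stmt-AtomisticToContinuum-13440`). The insertion lemma for a GENERAL
repulsive finite-range pair potential dresses the inserted particle `x = X 0` with a Jastrow factor
`F(X) = ∏ⱼ f(x − yⱼ)` vanishing near every bath particle, `Ψ_z(X) = θ(x − z) F(X) Φ(Y)`,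
`Y = (X 1, …, X n)`. This file provides the `z`-independent pointwise calculus:

* the affine slice `Z ↦ (x, Z)` (`hasFDerivAt_vecCons_right`, `fderiv_comp_vecCons_apply`): the
  kinetic density of the group `Fin.succ` at `(x, Z)` is the kinetic density of the slice
  (`insertionAssembly_kineticOn_succ_vecCons`), the interaction of the group is the `n`-body interaction
  (`interactionOn_succ_vecCons`);
* operator-norm and partial-derivative bounds for the sliced Jastrow factor `Z ↦ F(x, Z)` from the
  directional bounds of `F` (`norm_fderiv_sliceFactor_le`, `sq_fderiv_sliceFactor_single_le`);
* the derivative of the dressed product (`fderiv_dressed_apply`), the bound on its gradient in the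
  inserted particle (`partialGradSq_dressed_le`):
  `|∇₀Ψ_z|² ≤ 2|∇θ|²|Φ|² + 6|θ|² (Σⱼ (1 − f(x − yⱼ))) |Φ|²`, and the energy density at `(x, Z)`
  when the inserted particle does not interact (`energyDensity_dressed_vecCons`).
-/

noncomputable section

namespace Summit.AtomisticToContinuum.BoseEinsteinCondensation.Cruxes.OneBodyEntropyBound.Birth

open MeasureTheory Filter Topology
open scoped ENNReal NNReal
open Literature.MathematicalPhysics.QuantumManyBody.BoseGas

namespace InsertionAssembly

variable {n : ℕ}

/-- The affine slice `Z ↦ (x, Z)` has derivative `W ↦ (0, W)`. [folklore] -/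
theorem hasFDerivAt_vecCons_right (x : Space) (Z : Config n) :
    HasFDerivAt (fun Z : Config n => (Matrix.vecCons x Z : Config (n + 1)))
      ((0 : Config n →L[ℝ] Space).finCons (ContinuousLinearMap.id ℝ (Config n))) Z :=
  (hasFDerivAt_const x Z).finCons (F' := fun _ : Fin (n + 1) => Space) (hasFDerivAt_id Z)

/-- `W ↦ (0, W)` evaluated. [folklore] -/
theorem finCons_zero_id_apply (W : Config n) :
    ((0 : Config n →L[ℝ] Space).finCons (ContinuousLinearMap.id ℝ (Config n))) W =
      (Matrix.vecCons 0 W : Config (n + 1)) := by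
  funext i
  simp [ContinuousLinearMap.finCons, Matrix.vecCons]

/-- Inserting a frozen particle `0`, `Z ↦ (x, Z)`, is smooth (affine). [folklore] -/
theorem contDiff_vecCons_right {m : WithTop ℕ∞} (x : Space) :
    ContDiff ℝ m fun Z : Config n => (Matrix.vecCons x Z : Config (n + 1)) := by
  -- adapted from `CouplingPathSliceFloor.contDiff_vecCons_right`
  refine contDiff_pi.2 fun i => ?_
  refine Fin.cases ?_ (fun j => ?_) i
  · simp only [Matrix.cons_val_zero]
    exact contDiff_const
  · simp only [Matrix.cons_val_succ]
    exact contDiff_apply ℝ Space j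

/-- **Chain rule along the bath**: `D(K(x, ·))(Z) W = DK(x, Z) (0, W)`. [folklore] -/
theorem fderiv_comp_vecCons_apply {E' : Type*} [NormedAddCommGroup E'] [NormedSpace ℝ E']
    {K : Config (n + 1) → E'} (hK : Differentiable ℝ K) (x : Space) (Z W : Config n) :
    fderiv ℝ (fun Z : Config n => K (Matrix.vecCons x Z)) Z W =
      fderiv ℝ K (Matrix.vecCons x Z) (Matrix.vecCons 0 W) := by
  have h := ((hK (Matrix.vecCons x Z)).hasFDerivAt.comp Z (hasFDerivAt_vecCons_right x Z)).fderiv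
  rw [show (fun Z : Config n => K (Matrix.vecCons x Z)) =
      K ∘ fun Z : Config n => (Matrix.vecCons x Z : Config (n + 1)) from rfl, h,
    ContinuousLinearMap.comp_apply, finCons_zero_id_apply]

/-- `(0, e_j ⊗ u) = e_{j+1} ⊗ u` in `(ℝ³)^{n+1}`. [folklore] -/
theorem vecCons_zero_single (j : Fin n) (u : Space) :
    (Matrix.vecCons (0 : Space) (Pi.single j u) : Config (n + 1)) = Pi.single j.succ u := by
  -- adapted from `CouplingPathSliceFloor.vecCons_zero_single`
  funext i
  refine Fin.cases ?_ (fun i => ?_) i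
  · simp [Fin.succ_ne_zero]
  · simp [Pi.single_apply, Fin.succ_inj]

/-- `(0, W) = Σⱼ e_{j+1} ⊗ W j`. [folklore] -/
theorem vecCons_zero_eq_sum_single (W : Config n) :
    (Matrix.vecCons (0 : Space) W : Config (n + 1)) = ∑ j : Fin n, Pi.single j.succ (W j) := by
  funext i
  rw [Finset.sum_apply]
  refine Fin.cases ?_ (fun l => ?_) i
  · simp [Fin.succ_ne_zero]
  · simp [Pi.single_apply, Fin.succ_inj]

/-- `|∇(cφ)|² = |c|² |∇φ|²` pointwise, for a complex constant `c`. [folklore] -/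
theorem kineticDensity_const_mul_complex (c : ℂ) (φ : Config n → ℂ) (Y : Config n) :
    kineticDensity (fun Z => c * φ Z) Y = (‖c‖₊ : ℝ≥0∞) ^ 2 * kineticDensity φ Y := by
  -- adapted from `GroundStateDirichletForm.kineticDensity_const_mul_complex`
  unfold kineticDensity
  rw [show (fun Z => c * φ Z) = c • φ from rfl, fderiv_const_smul_field, Finset.mul_sum]
  refine Finset.sum_congr rfl fun i _ => ?_
  rw [Finset.mul_sum]
  refine Finset.sum_congr rfl fun a _ => ?_
  rw [Pi.smul_apply, _root_.smul_apply, smul_eq_mul, nnnorm_mul, ENNReal.coe_mul, mul_pow]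

end InsertionAssembly

/-- **The kinetic density of the bath group at `(x, Z)` is the kinetic density of the slice
`K(x, ·)` at `Z`** (registered helper stub of `stub_insertionAssembly`, part 1). [folklore] -/
theorem insertionAssembly_kineticOn_succ_vecCons :
    ∀ {n : ℕ} {K : Literature.MathematicalPhysics.QuantumManyBody.BoseGas.Config (n + 1) → ℂ},
      Differentiable ℝ K → ∀ (x : Literature.MathematicalPhysics.QuantumManyBody.BoseGas.Space)
        (Z : Literature.MathematicalPhysics.QuantumManyBody.BoseGas.Config n),
        Literature.MathematicalPhysics.QuantumManyBody.BoseGas.kineticOn (⇑(Fin.succEmb n)) K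
            (Matrix.vecCons x Z) =
          Literature.MathematicalPhysics.QuantumManyBody.BoseGas.kineticDensity
            (fun Z : Literature.MathematicalPhysics.QuantumManyBody.BoseGas.Config n =>
              K (Matrix.vecCons x Z)) Z := by
  intro n K hK x Z
  unfold kineticOn kineticDensity
  refine Finset.sum_congr rfl fun j _ => Finset.sum_congr rfl fun k _ => ?_
  rw [InsertionAssembly.fderiv_comp_vecCons_apply hK, InsertionAssembly.vecCons_zero_single,
    Fin.coe_succEmb]

namespace InsertionAssembly

variable {n : ℕ}

/-- The interaction of the bath group at `(x, Z)` is the `n`-body interaction of `Z`. [folklore] -/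
theorem interactionOn_succ_vecCons (v : ℝ → ℝ≥0∞) (x : Space) (Z : Config n) :
    interactionOn (⇑(Fin.succEmb n)) v (Matrix.vecCons x Z) = interaction v Z := by
  unfold interactionOn
  simp only [Fin.coe_succEmb, Matrix.cons_val_succ]

/-! ### The sliced Jastrow factor `Z ↦ F(x, Z)` -/

/-- **Operator norm of the sliced factor**: if `|DF(X)(e_{j+1} ⊗ w)| ≤ (1 − f(x₀ − x_{j+1}))‖w‖`
with `f ≥ 0`, then `‖D(F(x, ·))(Z)‖ ≤ n`. [folklore] -/
theorem norm_fderiv_sliceFactor_le {F : Config (n + 1) → ℝ} (hF : Differentiable ℝ F)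
    {f : Space → ℝ} (hf0 : ∀ z, 0 ≤ f z)
    (hFj : ∀ (X : Config (n + 1)) (j : Fin n) (w : Space),
      ‖fderiv ℝ F X (Pi.single j.succ w)‖ ≤ (1 - f (X 0 - X j.succ)) * ‖w‖)
    (x : Space) (Z : Config n) :
    ‖fderiv ℝ (fun Z : Config n => F (Matrix.vecCons x Z)) Z‖ ≤ n := by
  refine ContinuousLinearMap.opNorm_le_bound _ (Nat.cast_nonneg n) fun W => ?_
  rw [fderiv_comp_vecCons_apply hF, vecCons_zero_eq_sum_single, map_sum]
  calc ‖∑ j : Fin n, fderiv ℝ F (Matrix.vecCons x Z) (Pi.single j.succ (W j))‖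
      ≤ ∑ j : Fin n, ‖fderiv ℝ F (Matrix.vecCons x Z) (Pi.single j.succ (W j))‖ := norm_sum_le _ _
    _ ≤ ∑ _j : Fin n, ‖W‖ := Finset.sum_le_sum fun j _ => ?_
    _ = n * ‖W‖ := by simp
  calc ‖fderiv ℝ F (Matrix.vecCons x Z) (Pi.single j.succ (W j))‖
      ≤ (1 - f (Matrix.vecCons x Z 0 - Matrix.vecCons x Z j.succ)) * ‖W j‖ := hFj _ j (W j)
    _ ≤ 1 * ‖W‖ :=
        mul_le_mul (by linarith [hf0 (Matrix.vecCons x Z 0 - Matrix.vecCons x Z j.succ)])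
          (norm_le_pi_norm W j) (norm_nonneg _) zero_le_one
    _ = ‖W‖ := one_mul _

/-- **Partial derivatives of the sliced factor**: `(∂_{y_j,k} F(x, ·)(Z))² ≤ 1 − f(x − Z j)`.
[folklore] -/
theorem sq_fderiv_sliceFactor_single_le {F : Config (n + 1) → ℝ} (hF : Differentiable ℝ F)
    {f : Space → ℝ} (hf0 : ∀ z, 0 ≤ f z)
    (hFj : ∀ (X : Config (n + 1)) (j : Fin n) (w : Space),
      ‖fderiv ℝ F X (Pi.single j.succ w)‖ ≤ (1 - f (X 0 - X j.succ)) * ‖w‖)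
    (x : Space) (Z : Config n) (j : Fin n) (k : Fin 3) :
    (fderiv ℝ (fun Z : Config n => F (Matrix.vecCons x Z)) Z
        (Pi.single j (EuclideanSpace.single k (1 : ℝ)))) ^ 2 ≤ 1 - f (x - Z j) := by
  rw [fderiv_comp_vecCons_apply hF, vecCons_zero_single]
  have h := hFj (Matrix.vecCons x Z) j (EuclideanSpace.single k (1 : ℝ))
  simp only [Matrix.cons_val_zero, Matrix.cons_val_succ, PiLp.norm_single, norm_one,
    mul_one, Real.norm_eq_abs] at h
  have h1 : 1 - f (x - Z j) ≤ 1 := by linarith [hf0 (x - Z j)]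
  nlinarith [abs_nonneg (fderiv ℝ F (Matrix.vecCons x Z) (Pi.single j.succ
    (EuclideanSpace.single k (1 : ℝ)))), sq_abs (fderiv ℝ F (Matrix.vecCons x Z)
      (Pi.single j.succ (EuclideanSpace.single k (1 : ℝ))))]

/-! ### The dressed product `Ψ(X) = θ(x₀) F(X) Φ(Y)` -/

/-- The dressed product is `C¹`. [folklore] -/
theorem contDiff_dressed {θz : Space → ℂ} (hθ : ContDiff ℝ 1 θz) {F : Config (n + 1) → ℝ}
    (hF : ContDiff ℝ 1 F) {ψ : Config n → ℂ} (hψ : ContDiff ℝ 1 ψ) :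
    ContDiff ℝ 1 fun X : Config (n + 1) => θz (X 0) * ((F X : ℂ) * ψ (fun j => X j.succ)) :=
  (hθ.comp (contDiff_apply ℝ Space 0)).mul
    ((Complex.ofRealCLM.contDiff.comp hF).mul
      (hψ.comp (contDiff_pi.2 fun j : Fin n => contDiff_apply ℝ Space (Fin.succ j))))

/-- **Derivative of the dressed product** (Leibniz and chain rules):
`DΨ(X)V = θ'(x₀)[V 0] F Φ + θ(x₀) (DF(X)V Φ + F DΦ(Y)[V_bath])`. [folklore] -/
theorem fderiv_dressed_apply {θz : Space → ℂ} (hθ : Differentiable ℝ θz) {F : Config (n + 1) → ℝ}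
    (hF : Differentiable ℝ F) {ψ : Config n → ℂ} (hψ : Differentiable ℝ ψ) (X V : Config (n + 1)) :
    fderiv ℝ (fun X : Config (n + 1) => θz (X 0) * ((F X : ℂ) * ψ (fun j => X j.succ))) X V =
      fderiv ℝ θz (X 0) (V 0) * ((F X : ℂ) * ψ (fun j => X j.succ)) +
        θz (X 0) * (((fderiv ℝ F X V : ℝ) : ℂ) * ψ (fun j => X j.succ) +
          (F X : ℂ) * fderiv ℝ ψ (fun j => X j.succ) (fun j => V j.succ)) := by
  have hA : HasFDerivAt (fun X : Config (n + 1) => θz (X 0))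
      ((fderiv ℝ θz (X 0)).comp
        (ContinuousLinearMap.proj (R := ℝ) (φ := fun _ : Fin (n + 1) => Space) 0)) X :=
    (hθ (X 0)).hasFDerivAt.comp X
      (ContinuousLinearMap.proj (R := ℝ) (φ := fun _ : Fin (n + 1) => Space) 0).hasFDerivAt
  have hB1 : HasFDerivAt (fun X : Config (n + 1) => ψ (fun j => X j.succ))
      ((fderiv ℝ ψ (fun j => X j.succ)).comp (precompCLM Fin.succ)) X :=
    (hψ _).hasFDerivAt.comp X (precompCLM (Fin.succ : Fin n → Fin (n + 1))).hasFDerivAt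
  have hB2 : HasFDerivAt (fun X : Config (n + 1) => (F X : ℂ))
      (Complex.ofRealCLM.comp (fderiv ℝ F X)) X :=
    Complex.ofRealCLM.hasFDerivAt.comp X (hF X).hasFDerivAt
  rw [(hA.fun_mul (hB2.fun_mul hB1)).fderiv]
  simp only [_root_.add_apply, _root_.smul_apply, ContinuousLinearMap.coe_comp,
    Function.comp_apply, ContinuousLinearMap.proj_apply, Complex.ofRealCLM_apply, smul_eq_mul,
    precompCLM_apply, Function.comp_def]
  ring

/-- Auxiliary cast: a real inequality `a ≤ 2 g p + 2 c s p` in `ℝ≥0∞`. [folklore] -/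
theorem ofReal_le_two_two {a g p c s : ℝ} (hp : 0 ≤ p) (hc : 0 ≤ c) (hs : 0 ≤ s)
    (hg : 0 ≤ g) (h : a ≤ 2 * g * p + 2 * (c * (s * p))) :
    ENNReal.ofReal a ≤ 2 * ENNReal.ofReal g * ENNReal.ofReal p +
      2 * (ENNReal.ofReal c * (ENNReal.ofReal s * ENNReal.ofReal p)) := by
  refine (ENNReal.ofReal_le_ofReal h).trans (le_of_eq ?_)
  rw [ENNReal.ofReal_add (by positivity) (by positivity), ENNReal.ofReal_mul (by positivity),
    ENNReal.ofReal_mul (by positivity), ENNReal.ofReal_ofNat, ENNReal.ofReal_mul (by positivity),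
    ENNReal.ofReal_ofNat, ENNReal.ofReal_mul hc, ENNReal.ofReal_mul hs]

/-- **Gradient of the dressed product in the inserted particle.** With `0 ≤ F ≤ 1`,
`|DF(X)(e₀ ⊗ w)| ≤ (1 − F)‖w‖` and `1 − F ≤ Σⱼ (1 − f(x₀ − x_{j+1}))` (`0 ≤ f ≤ 1`):
`|∇₀Ψ|² ≤ 2|∇θ(x₀)|²|Φ(Y)|² + 6|θ(x₀)|² (Σⱼ (1 − f(x₀ − x_{j+1}))) |Φ(Y)|²`. [folklore] -/
theorem partialGradSq_dressed_le {θz : Space → ℂ} (hθ : Differentiable ℝ θz)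
    {F : Config (n + 1) → ℝ} (hF : Differentiable ℝ F) (hF01 : ∀ X, 0 ≤ F X ∧ F X ≤ 1)
    (hF0 : ∀ (X : Config (n + 1)) (w : Space),
      ‖fderiv ℝ F X (Pi.single 0 w)‖ ≤ (1 - F X) * ‖w‖)
    {f : Space → ℝ} (hf01 : ∀ z, 0 ≤ f z ∧ f z ≤ 1)
    (hFsum : ∀ X : Config (n + 1), 1 - F X ≤ ∑ j : Fin n, (1 - f (X 0 - X j.succ)))
    {ψ : Config n → ℂ} (hψ : Differentiable ℝ ψ) (X : Config (n + 1)) :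
    partialGradSq 0 (fun X : Config (n + 1) => θz (X 0) * ((F X : ℂ) * ψ (fun j => X j.succ))) X ≤
      2 * gradSqC θz (X 0) * (‖ψ (fun j => X j.succ)‖₊ : ℝ≥0∞) ^ 2 +
        6 * ((‖θz (X 0)‖₊ : ℝ≥0∞) ^ 2 *
          ((∑ j : Fin n, ENNReal.ofReal (1 - f (X 0 - X j.succ))) *
            (‖ψ (fun j => X j.succ)‖₊ : ℝ≥0∞) ^ 2)) := by
  set t : ℂ := ψ (fun j => X j.succ) with ht
  set s : ℝ := ∑ j : Fin n, (1 - f (X 0 - X j.succ)) with hs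
  have hs0 : 0 ≤ s := Finset.sum_nonneg fun j _ => by linarith [(hf01 (X 0 - X j.succ)).2]
  have hFs : (1 - F X) ^ 2 ≤ s := by
    have h1 := (hF01 X).1
    have h2 := (hF01 X).2
    nlinarith [hFsum X]
  -- per direction
  have hk : ∀ k : Fin 3,
      (‖fderiv ℝ (fun X : Config (n + 1) => θz (X 0) * ((F X : ℂ) * ψ (fun j => X j.succ))) X
          (Pi.single 0 (EuclideanSpace.single k (1 : ℝ)))‖₊ : ℝ≥0∞) ^ 2 ≤
        2 * (‖fderiv ℝ θz (X 0) (EuclideanSpace.single k (1 : ℝ))‖₊ : ℝ≥0∞) ^ 2 *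
            (‖t‖₊ : ℝ≥0∞) ^ 2 +
          2 * ((‖θz (X 0)‖₊ : ℝ≥0∞) ^ 2 *
            ((∑ j : Fin n, ENNReal.ofReal (1 - f (X 0 - X j.succ))) * (‖t‖₊ : ℝ≥0∞) ^ 2)) := by
    intro k
    have htail : (fun j : Fin n => (Pi.single (0 : Fin (n + 1)) (EuclideanSpace.single k (1 : ℝ)) :
        Config (n + 1)) j.succ) = 0 := by
      funext j
      simp [Fin.succ_ne_zero]
    rw [fderiv_dressed_apply hθ hF hψ, htail, map_zero, mul_zero, add_zero,
      ← ENNReal.ofReal_sum_of_nonneg (fun j _ => by linarith [(hf01 (X 0 - X j.succ)).2])]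
    simp only [Pi.single_eq_same, coe_nnnorm_pow_two_eq_ofReal]
    refine ofReal_le_two_two (sq_nonneg _) (sq_nonneg _) hs0 (sq_nonneg _) ?_
    -- the real inequality
    set a := fderiv ℝ θz (X 0) (EuclideanSpace.single k (1 : ℝ)) with ha
    set d : ℝ := fderiv ℝ F X (Pi.single 0 (EuclideanSpace.single k (1 : ℝ))) with hd
    have hdF : |d| ≤ 1 - F X := by
      have := hF0 X (EuclideanSpace.single k (1 : ℝ))
      rwa [PiLp.norm_single, norm_one, mul_one, Real.norm_eq_abs] at this
    have hnorm : ‖a * ((F X : ℂ) * t) + θz (X 0) * ((d : ℂ) * t)‖ ≤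
        ‖a‖ * ‖t‖ + ‖θz (X 0)‖ * ((1 - F X) * ‖t‖) := by
      refine (norm_add_le _ _).trans (add_le_add ?_ ?_)
      · rw [norm_mul, norm_mul, Complex.norm_real, Real.norm_eq_abs, abs_of_nonneg (hF01 X).1]
        calc ‖a‖ * (F X * ‖t‖) ≤ ‖a‖ * (1 * ‖t‖) := by gcongr; exact (hF01 X).2
          _ = ‖a‖ * ‖t‖ := by rw [one_mul]
      · rw [norm_mul, norm_mul, Complex.norm_real, Real.norm_eq_abs]
        gcongr
    have h2 : ‖a * ((F X : ℂ) * t) + θz (X 0) * ((d : ℂ) * t)‖ ^ 2 ≤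
        2 * (‖a‖ * ‖t‖) ^ 2 + 2 * (‖θz (X 0)‖ * ((1 - F X) * ‖t‖)) ^ 2 := by
      nlinarith [norm_nonneg (a * ((F X : ℂ) * t) + θz (X 0) * ((d : ℂ) * t)),
        sq_nonneg (‖a‖ * ‖t‖ - ‖θz (X 0)‖ * ((1 - F X) * ‖t‖)),
        mul_nonneg (norm_nonneg a) (norm_nonneg t),
        mul_nonneg (norm_nonneg (θz (X 0))) (mul_nonneg (by linarith [(hF01 X).2] : (0:ℝ) ≤ 1 - F X)
          (norm_nonneg t))]
    calc _ ≤ 2 * (‖a‖ * ‖t‖) ^ 2 + 2 * (‖θz (X 0)‖ * ((1 - F X) * ‖t‖)) ^ 2 := h2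
      _ = 2 * ‖a‖ ^ 2 * ‖t‖ ^ 2 + 2 * (‖θz (X 0)‖ ^ 2 * ((1 - F X) ^ 2 * ‖t‖ ^ 2)) := by ring
      _ ≤ 2 * ‖a‖ ^ 2 * ‖t‖ ^ 2 + 2 * (‖θz (X 0)‖ ^ 2 * (s * ‖t‖ ^ 2)) := by gcongr
  -- sum over the three directions
  unfold partialGradSq
  refine (Finset.sum_le_sum fun k _ => hk k).trans (le_of_eq ?_)
  rw [Finset.sum_add_distrib, Finset.sum_const, Finset.card_univ, Fintype.card_fin,
    nsmul_eq_mul, ← Finset.sum_mul, ← Finset.mul_sum, gradSqC, ht]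
  push_cast
  ring

/-- Restricting the dressed product to the slice `Z ↦ (x, Z)`. [folklore] -/
theorem dressed_comp_vecCons (θz : Space → ℂ) (F : Config (n + 1) → ℝ) (ψ : Config n → ℂ)
    (x : Space) :
    (fun Z : Config n => (fun X : Config (n + 1) => θz (X 0) * ((F X : ℂ) * ψ (fun j => X j.succ)))
        (Matrix.vecCons x Z)) =
      fun Z : Config n => θz x * ((F (Matrix.vecCons x Z) : ℂ) * ψ Z) := by
  funext Z
  simp only [Matrix.cons_val_zero, Matrix.cons_val_succ]

/-- **Energy density of the dressed product at `(x, Z)`** when the inserted particle does not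
interact (`v(|x − Z j|) = 0` or `F(x, Z) = 0` for every `j`):
`|∇Ψ|² + V|Ψ|² = |∇₀Ψ|² + |θ(x)|² (|∇(FΦ)(x,·)|²(Z) + V(Z)|F(x,Z)Φ(Z)|²)`. [folklore] -/
theorem energyDensity_dressed_vecCons {θz : Space → ℂ} (hθ : Differentiable ℝ θz)
    {F : Config (n + 1) → ℝ} (hF : Differentiable ℝ F) {ψ : Config n → ℂ} (hψ : Differentiable ℝ ψ)
    (v : ℝ → ℝ≥0∞) (x : Space) (Z : Config n)
    (hcross : ∀ j : Fin n, v (dist x (Z j)) = 0 ∨ F (Matrix.vecCons x Z) = 0) :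
    kineticDensity (fun X : Config (n + 1) => θz (X 0) * ((F X : ℂ) * ψ (fun j => X j.succ)))
          (Matrix.vecCons x Z) +
        interaction v (Matrix.vecCons x Z) *
          (‖(fun X : Config (n + 1) => θz (X 0) * ((F X : ℂ) * ψ (fun j => X j.succ)))
            (Matrix.vecCons x Z)‖₊ : ℝ≥0∞) ^ 2 =
      partialGradSq 0 (fun X : Config (n + 1) => θz (X 0) * ((F X : ℂ) * ψ (fun j => X j.succ)))
          (Matrix.vecCons x Z) +
        (‖θz x‖₊ : ℝ≥0∞) ^ 2 *
          (kineticDensity (fun Z : Config n => (F (Matrix.vecCons x Z) : ℂ) * ψ Z) Z +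
            interaction v Z * (‖(F (Matrix.vecCons x Z) : ℂ) * ψ Z‖₊ : ℝ≥0∞) ^ 2) := by
  have hd : Differentiable ℝ
      (fun X : Config (n + 1) => θz (X 0) * ((F X : ℂ) * ψ (fun j => X j.succ))) :=
    (hθ.comp (ContinuousLinearMap.proj (R := ℝ) (φ := fun _ : Fin (n + 1) => Space) 0).differentiable).mul
      ((Complex.ofRealCLM.differentiable.comp hF).mul
        (hψ.comp (precompCLM (Fin.succ : Fin n → Fin (n + 1))).differentiable))
  have hcross0 : (∑ j : Fin n, v (dist (Matrix.vecCons x Z 0) (Matrix.vecCons x Z j.succ))) *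
      ((‖θz x‖₊ : ℝ≥0∞) ^ 2 * (‖(F (Matrix.vecCons x Z) : ℂ) * ψ Z‖₊ : ℝ≥0∞) ^ 2) = 0 := by
    simp only [Matrix.cons_val_zero, Matrix.cons_val_succ]
    by_cases hF0 : F (Matrix.vecCons x Z) = 0
    · rw [hF0]; simp
    · have : ∑ j : Fin n, v (dist x (Z j)) = 0 :=
        Finset.sum_eq_zero fun j _ => (hcross j).resolve_right hF0
      rw [this, zero_mul]
  rw [DenseCell.kineticDensity_eq_partialGradSq_add_kineticOn,
    DenseCell.interaction_eq_cross_add_interactionOn, insertionAssembly_kineticOn_succ_vecCons hd,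
    interactionOn_succ_vecCons, dressed_comp_vecCons, kineticDensity_const_mul_complex]
  simp only [Matrix.cons_val_zero, Matrix.cons_val_succ]
  rw [ennnorm_mul_sq (θz x), add_mul]
  simp only [Matrix.cons_val_zero, Matrix.cons_val_succ] at hcross0
  rw [hcross0, zero_add]
  ring

/-! ### The sliced product factor and the dressed trial function -/

/-- The sliced product factor `Z ↦ ∏ⱼ f(x − Z j)` is Bose-symmetric in the bath. [folklore] -/
theorem sliceFactor_symm (f : Space → ℝ) (x : Space) (σ : Equiv.Perm (Fin n)) (Z : Config n) :
    (fun Z : Config n => (fun X : Config (n + 1) => ∏ j : Fin n, f (X 0 - X j.succ))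
        (Matrix.vecCons x Z)) (Z ∘ σ) =
      (fun Z : Config n => (fun X : Config (n + 1) => ∏ j : Fin n, f (X 0 - X j.succ))
        (Matrix.vecCons x Z)) Z := by
  simp only [Matrix.cons_val_zero, Matrix.cons_val_succ, Function.comp_apply]
  exact Fintype.prod_equiv σ _ _ fun j => rfl

/-- **The dressed particle does not interact**: if `f = 0` on the closed ball of radius `R₁ > R₀`
and `v = 0` beyond `R₀`, then for every bath particle `v(|x − Z j|) = 0` or the product factor
vanishes. [folklore] -/
theorem cross_or_factor_eq_zero {v : ℝ → ℝ≥0∞} {R₀ R₁ : ℝ} (hR : R₀ < R₁)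
    (hv : ∀ r, R₀ < r → v r = 0) {f : Space → ℝ} (hfR : ∀ z : Space, ‖z‖ ≤ R₁ → f z = 0)
    (x : Space) (Z : Config n) (j : Fin n) :
    v (dist x (Z j)) = 0 ∨ (fun X : Config (n + 1) => ∏ j : Fin n, f (X 0 - X j.succ))
      (Matrix.vecCons x Z) = 0 := by
  by_cases h : f (x - Z j) = 0
  · right
    simp only [Matrix.cons_val_zero, Matrix.cons_val_succ]
    exact Finset.prod_eq_zero (Finset.mem_univ j) h
  · left
    refine hv _ (hR.trans ?_)
    rw [dist_eq_norm]
    by_contra hle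
    exact h (hfR _ (not_lt.1 hle))

/-- The dressed trial function vanishes off `Λ_L^{n+1}` when the one-body window `z + Λ_b` lies in
`Λ_L`. [folklore] -/
theorem dressed_eq_zero {L b : ℝ} (Φ : TrialState n L) (Θ : TrialState 1 b) (F : Config (n + 1) → ℝ)
    {z : Space} (hz : ∀ x : Space, x - z ∈ box b → x ∈ box L) (X : Config (n + 1))
    (hX : X ∉ boxN (n + 1) L) :
    (fun X : Config (n + 1) => Θ.ψ (fun _ => X 0 - z) * ((F X : ℂ) * Φ.ψ (fun j => X j.succ))) X
      = 0 := by
  by_contra hne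
  apply hX
  have h1 : Θ.ψ (fun _ => X 0 - z) ≠ 0 := fun h => hne (by simp only [h, zero_mul])
  have h2 : Φ.ψ (fun j => X j.succ) ≠ 0 := fun h => hne (by simp only [h, mul_zero])
  have hx0 : X 0 ∈ box L := by
    have : (fun _ : Fin 1 => X 0 - z) ∈ boxN 1 b := by
      by_contra hc; exact h1 (Θ.eq_zero _ hc)
    exact hz _ (this 0)
  have hxs : ∀ j : Fin n, X j.succ ∈ box L := by
    have : (fun j : Fin n => X j.succ) ∈ boxN n L := by
      by_contra hc; exact h2 (Φ.eq_zero _ hc)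
    exact fun j => this j
  intro i
  exact Fin.cases hx0 (fun j => hxs j) i

end InsertionAssembly

end Summit.AtomisticToContinuum.BoseEinsteinCondensation.Cruxes.OneBodyEntropyBound.Birth

end
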